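import Literature.Algebra.Polynomial.CasasAlvero.Degree4CharP
import HarnessLib

/-!
# The converse of GvBLSW Prop. 6: `CA_{n·p^k}(K) ⇒ CA_n(K)` in characteristic `p`

If `f` is a monic Casas-Alvero polynomial of degree `n` over a field `K` of characteristic `p`, then `f^(p^k)` is a monic
Casas-Alvero polynomial of degree `n·p^k` (`H_{j p^k}(f^(p^k)) = (H_j f)^(p^k)` and `H_i(f^(p^k)) = 0` for `p^k ∤ i`, by Lucas),
and `f^(p^k) = (X - a)^(n p^k)` forces `f = (X - a)^n` (Frobenius is injective on `K[X]`).  Hence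
`HoldsInDegree K (n * p^k) → HoldsInDegree K n` over EVERY field of characteristic `p` (no perfectness needed), and together with
Prop. 6 (`holdsInDegree_mul_prime_pow`, perfect `K`) the equivalence `CA_{n p^k}(K) ⟺ CA_n(K)` over perfect fields.
Negative transfer: every failure `¬ CA_n(K)` propagates to `¬ CA_{n p^k}(K)` — e.g. `CA_{3·2^k}` fails in characteristic 2 and
`CA_{4·q^k}` fails in characteristic `q ∈ {3, 5, 7}`.  [cite: GrafVonBothmerEtAl2007, Prop. 6]
-/

noncomputable section

open Polynomial

namespace Literature.Algebra.Polynomial.CasasAlvero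

variable (p : ℕ) [hp : Fact p.Prime]
variable {K : Type*} [Field K] [CharP K p]

/-- In characteristic `p`: `H_i (g^(p^k)) = 0` whenever `p^k ∤ i` (Lucas). [folklore] -/
theorem hasseDeriv_pow_prime_pow_eq_zero (g : K[X]) (k : ℕ) {i : ℕ} (hi : ¬ p ^ k ∣ i) :
    hasseDeriv i (g ^ p ^ k) = 0 := by
  ext m
  rw [hasseDeriv_coeff, coeff_pow_prime_pow p, coeff_zero]
  by_cases hm : p ^ k ∣ m + i
  · rw [if_pos hm, cast_choose_eq_zero_of_pow_dvd K p hm hi, zero_mul]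
  · rw [if_neg hm, mul_zero]

/-- The `p^k`-th power of a monic Casas-Alvero polynomial is Casas-Alvero (characteristic `p`). [cite: GrafVonBothmerEtAl2007, Prop. 6] -/
theorem IsCasasAlvero.pow_prime_pow {f : K[X]} (hf : f.Monic) (hca : IsCasasAlvero f) (k : ℕ) :
    IsCasasAlvero (f ^ p ^ k) := by
  have hq : 0 < p ^ k := pow_pos hp.out.pos k
  intro i hi0 hi
  rw [hf.natDegree_pow] at hi
  by_cases hdvd : p ^ k ∣ i
  · obtain ⟨j, rfl⟩ := hdvd
    have hj0 : 0 < j := Nat.pos_of_ne_zero (by rintro rfl; simp at hi0)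
    have hjn : j < f.natDegree := by
      by_contra hle
      exact absurd hi (not_lt.mpr (Nat.mul_le_mul_left _ (not_lt.mp hle)))
    obtain ⟨a, ha1, ha2⟩ := hca j hj0 hjn
    refine ⟨a, ?_, ?_⟩
    · rw [eval_pow, ha1, zero_pow hq.ne']
    · rw [mul_comm, hasseDeriv_mul_prime_pow_pow p, eval_pow, ha2, zero_pow hq.ne']
  · have hroot : ∃ a, eval a f = 0 := by
      rcases Nat.lt_or_ge 1 f.natDegree with h2 | h1
      · obtain ⟨a, ha, -⟩ := hca 1 one_pos h2
        exact ⟨a, ha⟩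
      · have hd1 : f.natDegree = 1 := by
          rcases Nat.eq_zero_or_pos f.natDegree with h0 | hpos
          · rw [h0, mul_zero] at hi; omega
          · omega
        obtain ⟨c, hc⟩ : ∃ c : K, f = X + C c := ⟨f.coeff 0, hf.eq_X_add_C hd1⟩
        refine ⟨-c, ?_⟩
        rw [hc]
        simp
    obtain ⟨a, ha⟩ := hroot
    refine ⟨a, ?_, ?_⟩
    · rw [eval_pow, ha, zero_pow hq.ne']
    · rw [hasseDeriv_pow_prime_pow_eq_zero p f k hdvd, eval_zero]

/-- **Converse of GvBLSW Prop. 6**: `CA_{n·p^k}(K) ⇒ CA_n(K)` over every field of characteristic `p`.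
[cite: GrafVonBothmerEtAl2007, Prop. 6] -/
theorem holdsInDegree_of_mul_prime_pow {n : ℕ} (k : ℕ) (h : HoldsInDegree K (n * p ^ k)) : HoldsInDegree K n := by
  intro f hf hd hca
  have hq : 0 < p ^ k := pow_pos hp.out.pos k
  obtain ⟨a, ha⟩ := h (f ^ p ^ k) (hf.pow _) (by rw [hf.natDegree_pow, hd, mul_comm])
    (IsCasasAlvero.pow_prime_pow p hf hca k)
  refine ⟨a, ?_⟩
  have h0 : (f - (X - C a) ^ n) ^ p ^ k = 0 := by
    rw [sub_pow_char_pow, ha, ← pow_mul, sub_self]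
  exact sub_eq_zero.mp ((pow_eq_zero_iff hq.ne').mp h0)

/-- Prop. 6 as an equivalence over perfect fields of characteristic `p`: `CA_{n p^k}(K) ⟺ CA_n(K)`.
[cite: GrafVonBothmerEtAl2007, Prop. 6] -/
theorem holdsInDegree_mul_prime_pow_iff [PerfectRing K p] (n k : ℕ) :
    HoldsInDegree K (n * p ^ k) ↔ HoldsInDegree K n :=
  ⟨holdsInDegree_of_mul_prime_pow p k, fun h => holdsInDegree_mul_prime_pow p h k⟩

/-- Negative transfer: a failure in degree `n` propagates to every degree `n · p^k` (same field). [cite: GrafVonBothmerEtAl2007, Prop. 6] -/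
theorem not_holdsInDegree_mul_prime_pow {n : ℕ} (k : ℕ) (h : ¬ HoldsInDegree K n) :
    ¬ HoldsInDegree K (n * p ^ k) :=
  fun h' => h (holdsInDegree_of_mul_prime_pow p k h')

omit [CharP K p] in
/-- `CA_{3·2^k}` fails over every field of characteristic 2. [cite: GrafVonBothmerEtAl2007, Prop. 6] -/
theorem not_holdsInDegree_three_mul_two_pow [CharP K 2] (k : ℕ) : ¬ HoldsInDegree K (3 * 2 ^ k) := by
  have : Fact (Nat.Prime 2) := ⟨Nat.prime_two⟩
  refine not_holdsInDegree_mul_prime_pow 2 k ?_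
  rw [holdsInDegree_three_iff]
  simpa using CharP.cast_eq_zero K 2

omit hp in
/-- `CA_{4·p^k}` fails over every field of characteristic `p ∈ {3, 5, 7}`. [cite: GrafVonBothmerEtAl2007, Prop. 6] -/
theorem not_holdsInDegree_four_mul_prime_pow (h357 : p = 3 ∨ p = 5 ∨ p = 7) (k : ℕ) :
    ¬ HoldsInDegree K (4 * p ^ k) := by
  have hpp : p.Prime := by rcases h357 with rfl | rfl | rfl <;> norm_num
  have : Fact p.Prime := ⟨hpp⟩
  refine not_holdsInDegree_mul_prime_pow p k ?_
  rw [holdsInDegree_four_iff]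
  have hp0 : (p : K) = 0 := CharP.cast_eq_zero K p
  rcases h357 with rfl | rfl | rfl
  · push_cast at hp0; exact fun h => h.1 hp0
  · push_cast at hp0; exact fun h => h.2.1 hp0
  · push_cast at hp0; exact fun h => h.2.2 hp0

end Literature.Algebra.Polynomial.CasasAlvero
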